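import Literature.MathematicalPhysics.QuantumFieldTheory.Balaban1983to89.B8Lemma1NonAbelianRecLoops

/-!
# `Balaban1983to89.B8Lemma1NonAbelianRec` — [Balaban1985RegularSpaces] Lemma 1 (p. 79), (1.24) ⇒ (1.25) `|V′ − 1| < 4d²α₀ + α₁`, RE-PROVED FOR THE
# RECORD'S SYMMETRIC BLOCK AVERAGING (0.4) of [Balaban1987RG1] (centred blocks, all shortest staircases — `BlockAveragingZd.bavgZ`) on the `ℤᵈ`
# carriers, non-abelian (`U1 𝔸 ⊇ U(N)`-valued fields); the DAG leaf `B8.Lemma1Printed d (blockPairNA d L 𝔸)` of record discharged (odd `L`)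

statement-level skeleton of published theorems with citation tags; proofs where landed; nothing here is a claim about the Yang–Mills mass gap

CITATION HEADER.  [6] = T. Bałaban, *Spaces of regular gauge field configurations on a lattice and gauge fixing conditions*, Commun. Math. Phys. **99**
(1985) 75–102 [Balaban1985RegularSpaces], p. 79, verbatim: *«Lemma 1. Let V₀, V′V₀ satisfy the condition (1.7) for k = 1 and L arbitrary, and let
(R(V₀)V′)(Γ_{y,x}) = 1 for x ∈ B(y), |\overline{V′V₀} − V̄₀| < α₁ on Ω₁^{(1)}. (1.24)  Then for α₀, α₁ small the configuration V′ is also small, more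
precisely we have the bound |V′ − 1| < 4d²α₀ + α₁ on Ω₁. (1.25)»*; p. 80: *«the result is local in the sense that the bound (1.25) for a bond b depends on
bounds (1.7), (1.24) on B(c₋)∪B(c₊), if b belongs to this set»*.  [I] = T. Bałaban, *Renormalization group approach to lattice gauge field theories. I*,
Commun. Math. Phys. **109** (1987) 249–301 [Balaban1987RG1], (0.3)–(0.4) pp. 252–253 (the averaging of record) and p. 253–254 «The considerations and
results … are valid universally for all averages satisfying the above properties … The proofs are in most cases unchanged» (the licence this re-proof
makes good for Lemma 1).  [3] = [Balaban1985Averaging], (42) p. 23, pp. 24–25.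
Cell `pub-ymgap`, seat `pub-ymgap-dag-n05-d` g23 — «N05-REC» road (director-ym №254∕№255, plan g90 SIZING WORD; LEAD PEN dag-n05-e: R0a = `BlockAveragingZd`
p690042; TOKEN RULE `N05-REC-LEAD.md` §2: (T1) `bavg ↦ bavgZ`, `Xavg ↦ XZ`; (T2) `boxVec ↦ offZ` (blocks based at `L·z`, CENTRED); (T3) axial data =
the engine's `axialFn` from the centre; (T5) engine names kept).  Item R2, twin of `B8Lemma1NonAbelian` §6–§8; the loop estimate is the sibling
`B8Lemma1NonAbelianRecLoops`.  `--kind proof --supports stmt-QuantumFields-20541` (K0⁷; count-neutral).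

WHAT IS PROVED (kernel, sorry-free; axioms `propext`∕`Classical.choice`∕`Quot.sound`).
§7 `interior_bound` (base point anywhere in the box: `|U_bV₀,b⁻¹ − 1| ≤ 2(Σ_{κ<μ}|x_κ − y_κ|)a`), `norm_axial_tree_sub_one_le` (the T-factor `Γ_{c₊,x′}` of the
far block read in the gauge at `q`: `≤ a(sL·#{μ>κ} + s²d(d−1)∕2)`), `bond_tree_le_omega`, `crossing_bound` (via the engine's algebraic `crossing_identity`,
REUSED: `≤ 2ω + α₁e^{3t} + e^{2t} − 1`), the hypothesis record `Hyp` (engine's `Hyp` with `boxVec ↦ offZ`, `bavg ↦ bavgZ`, box `[q − s𝟙, q + Le_κ + s𝟙]`),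
★★ `lemma1_explicit` (`6ω ≤ 1 ⇒ |V′_b − 1| ≤ α₁ + ω(10 + 12α₁)` on every bond of `B(c₋) ∪ B(c₊)`), ★★★ `lemma1_printedBound` (`a = α₀L⁻²`, `0 < α₀ ≤
1∕(6(d+1)(d+2))`, `0 ≤ α₁ ≤ 1∕6` ⇒ `< 4d²α₀ + α₁`: `ω ≤ (d−1)(d+2)α₀∕4` and `3(d−1)(d+2) < 4d²` since `d² − 3d + 6 > 0`).  §8 the carriers of record
`Small ∕ AxialClose ∕ blockSites ∕ pairSites ∕ regionBonds ∕ pertDev ∕ blockPairNA` and ★★★ `lemma1Printed_blockPairNA (d L) (hL : Odd L) 𝔸 :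
B8.Lemma1Printed d (blockPairNA d L 𝔸)` (smallness constant `c = 1∕(6(d+1)(d+2))`); `lemma1_unitary` (unitary-valued fields of a C⋆-algebra).

PROOF ROUTE = the engine's gauge-invariant route (loops of the average + ONE algebraic factorisation per crossing bond), with the loop bound of the sibling
module in place of the engine's §4; constants: `ω = (d−1)s(ds+L)a` replaces `(d−1)(L−1)La`; the printed `4d²α₀ + α₁` is kept; the smallness constant of
the leaf becomes `1∕(6(d+1)(d+2))` (engine `1∕(6(d+1))`) because the record's loops are longer.  The (1.24) axial conditions are taken in the transporter
form `U(Γ_{z,x}) = V₀(Γ_{z,x})` from both block CENTRES (the engine's forward-only product `covProd` (1.19) does not apply verbatim to centred trees, which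
have backward bonds — located on the cell bus 2026-08-29, POINT 2; the transporter form is the one every consumer uses, `B8Eq119TwistedAxial.inAx_iff`).

HONEST SCOPE.  (i) Model and locality as in the engine's HONEST SCOPE (i)–(v) (`U1 𝔸`, only (1.7)`_{k=1}` on `B(c₋) ∪ B(c₊)`, `≤`-hypotheses ∕ `<`-carriers,
explicit smallness in place of «α₀, α₁ small»); odd `L` (the record's).  (ii) UNGUARDED edition `bavgZ` (TOKEN RULE (T1); the guarded `bavgZG` agrees on the
small-field domain, `BlockAveragingZd.bavgZG_eq_bavgZ_of_small` — a DISPLAYED letter at the R7 bridge, not here).  (iii) This file discharges ONE DAG leaf for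
the record carriers and NOTHING of `HThm4Rec` (N07's conditional premise stays undischarged until the road's R7 inhabitant lands); N05 ∕ N07 NOT discharged;
counts unmoved (typed 28∕28 · discharged 7∕28); one finite 𝕋⁴ programme at fixed ε — nothing continuum ∕ ℝ⁴ ∕ OS ∕ mass gap ∕ Clay.  No `instance`, no
`notation`, no `sorry`.
-/

noncomputable section

open scoped BigOperators
open NormedSpace Finset

namespace Literature.MathematicalPhysics.QuantumFieldTheory.Balaban1983to89.B8Lemma1NonAbelianRec

open B7Prop1Explicit MatrixLog BlockAveragingZd B8Lemma1NonAbelianRecLoops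
open B8Lemma1NonAbelian (lowPart lowPart_apply lowPart_add lowPart_sub lowPart_zero lowPart_zsmul_e_of_le
  lowPart_zsmul_e_of_lt zsmul_e_apply zsmul_e_apply_self e_apply_self e_apply_of_ne l1_lowPart_eq e_nonneg
  zsmul_e_nonneg tw tw_nil tw_cons treeWord_eq_tw axial_bond_eq_sharp
  axial_treeBond_eq_one treeWord_zsmul_e hol_axial_seg_base norm_exp_le_of_norm_le exp_pow_le_one_add
  norm_triple_sub_one_le mulCfg pert pert_mulCfg covProd norm_units_mul_sub_one_le Tfac Tfac_eq crossing_identity)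
open B8Ineq129 (vec_apply axial_bond_bound_box l1_lowPart_le)
open T4Continuum (stairWord stairRuns axisRun loopWord wordRev)

-- `Site` alone would resolve to the torus sites of `Setup.lean`; re-export the `ℤᵈ` sites of `B7Prop1Explicit`.
export B7Prop1Explicit (Site)

variable {d : ℕ}

/-! ## §7 Lemma 1 on the bonds of `B(c₋) ∪ B(c₊)` (centred blocks, record average) -/

section Lemma1

variable {𝔸 : Type*} [NormedRing 𝔸] [NormOneClass 𝔸] [NormedAlgebra ℂ 𝔸] [CompleteSpace 𝔸]

omit [NormedAlgebra ℂ 𝔸] [CompleteSpace 𝔸] in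
/-- **Interior bonds** (p. 79 «The conditions `(R₀V′)(Γ_{y,x}) = 1, x ∈ B(y)`, imply `V′_b = 1` for `b ⊂ Γ_{y,x}` … `|V′_b − 1| < (d−1)(L−1)2α₀L⁻²`
for `b ⊂ B(y)`»), base point `y` ANYWHERE in the box (the CENTRE of the block): for a bond `⟨x, x + e_μ⟩` with both axial conditions at `x`
and `x + e_μ`, `|U_b V₀,b⁻¹ − 1| ≤ 2 (Σ_{κ<μ} |x_κ − y_κ|) a`. [cite: Balaban1985RegularSpaces, p.79] -/
theorem interior_bound (U V₀ : Site d → Fin d → 𝔸ˣ) (hU : ∀ x κ, U x κ ∈ U1 𝔸) (hV₀ : ∀ x κ, V₀ x κ ∈ U1 𝔸)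
    {lo hi : Site d} {a : ℝ} (hPU : B8Lemma1NonAbelian.PlaqSmall U lo hi a) (hP0 : B8Lemma1NonAbelian.PlaqSmall V₀ lo hi a)
    (ha : 0 ≤ a) (y x : Site d) (μ : Fin d) (hy : lo ≤ y) (hy' : y ≤ hi) (hx : lo ≤ x) (hhi : x + e μ ≤ hi)
    (hAx : axialFn U y x = axialFn V₀ y x) (hAx' : axialFn U y (x + e μ) = axialFn V₀ y (x + e μ)) :
    ‖((pert U V₀ x μ : 𝔸ˣ) : 𝔸) - 1‖ ≤ 2 * (l1 (lowPart μ (x - y)) * a) := by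
  have hid : pert U V₀ x μ = (axialFn V₀ y x)⁻¹ *
      (gaugeAct (axialFn U y) U x μ * (gaugeAct (axialFn V₀ y) V₀ x μ)⁻¹) * axialFn V₀ y x := by
    simp only [pert, gaugeAct, hAx, hAx']; group
  rw [hid, Units.val_mul, Units.val_mul]
  refine (norm_units_inv_conj_sub_one_le (axialFn_mem hV₀ y x) _).trans ?_
  have h1 := (axial_bond_bound_box U hU hPU ha y x μ hx hy hhi hy').1
  have h2 := (axial_bond_bound_box V₀ hV₀ hP0 ha y x μ hx hy hhi hy').1
  calc _ ≤ _ + _ := norm_units_mul_sub_one_le (gaugeAct_mem hU (axialFn_mem hU y) x μ)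
    _ ≤ _ + _ := add_le_add h1 ((norm_inv_sub_one_le (gaugeAct_mem hV₀ (axialFn_mem hV₀ y) x μ)).trans h2)
    _ = _ := by ring

omit [NormOneClass 𝔸] [NormedAlgebra ℂ 𝔸] [CompleteSpace 𝔸] in
/-- A point `q′ + n′` of the far block (`q′ = q + Le_κ`, `|n′_j| ≤ s`) lies in the box; so does a point `q + n` of the near block. [cite: Balaban1985RegularSpaces, (1.23) p.79 (bookkeeping)] -/
theorem mem_pairBox_blocks {L s : ℕ} (hL : L = 2 * s + 1) (q : Site d) (κ : Fin d) {n : Site d}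
    (hn : ∀ j, (n j).natAbs ≤ s) :
    (pairLo L q ≤ q + n ∧ q + n ≤ pairHi L q κ) ∧
      (pairLo L q ≤ q + (L : ℤ) • e κ + n ∧ q + (L : ℤ) • e κ + n ≤ pairHi L q κ) := by
  have hnb : ∀ j, -(s : ℤ) ≤ n j ∧ n j ≤ s := fun j => by have := hn j; omega
  refine ⟨mem_pairBox_of hL q κ _ fun j => ?_, mem_pairBox_of hL q κ _ fun j => ?_⟩
  · have := hnb j
    simp only [Pi.add_apply, add_sub_cancel_left]
    refine ⟨this.1, fun _ => this.2, fun _ => by omega⟩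
  · have := hnb j
    simp only [Pi.add_apply, zsmul_e_apply]
    refine ⟨by split_ifs <;> omega, fun hj => ?_, fun hj => ?_⟩
    · rw [if_neg hj]; omega
    · rw [if_pos hj]; omega

omit [NormedAlgebra ℂ 𝔸] [CompleteSpace 𝔸] in
/-- **The T-factor of the crossing bonds** (the tree contour `Γ_{c₊,x′}` of the far block, based at ITS centre `c₊ = q + Le_κ`, read in the tree
gauge at `q`): `|V^q(Γ_{c₊, c₊+n′}) − 1| ≤ a·(s·L·#{μ > κ} + s²·d(d−1)∕2)` — only its bonds of directions `μ > κ` see the offset `L e_κ`.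
[cite: Balaban1985RegularSpaces, p.79; Balaban1985Averaging, pp.24–25] -/
theorem norm_axial_tree_sub_one_le {L s : ℕ} (hL : L = 2 * s + 1) (W : Site d → Fin d → 𝔸ˣ) (hW : ∀ x κ, W x κ ∈ U1 𝔸)
    {lo hi : Site d} {a : ℝ} (hP : B8Lemma1NonAbelian.PlaqSmall W lo hi a) (ha : 0 ≤ a) (q : Site d) (κ : Fin d)
    (hlo : lo ≤ pairLo L q) (hhi : pairHi L q κ ≤ hi) (n' : Site d) (hn' : ∀ j, (n' j).natAbs ≤ s) :
    ‖((hol (gaugeAct (axialFn W q) W) (q + (L : ℤ) • e κ) (treeWord n') : 𝔸ˣ) : 𝔸) - 1‖ ≤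
      a * ((s : ℝ) * ((L : ℝ) * ∑ μ : Fin d, (if κ < μ then (1 : ℝ) else 0)) +
        (s : ℝ) ^ 2 * ((d : ℝ) * ((d : ℝ) - 1) / 2)) := by
  have hWm : ∀ x μ, gaugeAct (axialFn W q) W x μ ∈ U1 𝔸 := gaugeAct_mem hW (axialFn_mem hW q)
  have hq : lo ≤ q ∧ q ≤ hi := ⟨hlo.trans (base_mem_pairBox hL q κ).1, (base_mem_pairBox hL q κ).2.trans hhi⟩
  have hz : ∀ j, ((0 : Site d) j).natAbs ≤ s := fun j => by simp
  have hqL' := (mem_pairBox_blocks hL q κ hz).2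
  rw [add_zero] at hqL'
  have hqL : lo ≤ q + (L : ℤ) • e κ ∧ q + (L : ℤ) • e κ ≤ hi := ⟨hlo.trans hqL'.1, hqL'.2.trans hhi⟩
  have hqLn' := (mem_pairBox_blocks hL q κ hn').2
  have hqLn : lo ≤ q + (L : ℤ) • e κ + n' ∧ q + (L : ℤ) • e κ + n' ≤ hi := ⟨hlo.trans hqLn'.1, hqLn'.2.trans hhi⟩
  have hnd : ((List.finRange d).reverse).Nodup := List.nodup_reverse.mpr (List.nodup_finRange d)
  refine (norm_hol_sub_one_le_walkSum hWm _ _).trans ?_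
  rw [treeWord_eq_stairRuns_reverse]
  refine (walkSum_stairRuns_le W hW hP ha q hq.1 hq.2 n' _ hnd (q + (L : ℤ) • e κ) hqL.1 hqL.2
    fun j _ => ⟨hqLn.1 j, hqLn.2 j⟩).trans ?_
  refine (stairSum_le q ha n' hn' (fun μ => (L : ℝ) * (if κ < μ then (1 : ℝ) else 0)) _ (q + (L : ℤ) • e κ) 0
    fun μ _ => by rw [add_sub_cancel_left, l1_lowPart_smul_e, add_zero]).trans (le_of_eq ?_)
  rw [List.map_reverse, List.sum_reverse, ← Fin.sum_univ_def, List.length_reverse, List.length_finRange,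
    ← Finset.mul_sum]
  simp

/-- **Bookkeeping of the crossing bonds**: the bond cost `Σ_{i<κ}|n_i|·a` plus the T-factor cost fit inside `ω`:
`s·#{i<κ}·a + a(sL·#{μ>κ} + s²d(d−1)∕2) ≤ (d−1)·s·(ds + L)·a`. [cite: Balaban1985RegularSpaces, Lemma 1 p.79 (bookkeeping)] -/
theorem bond_tree_le_omega {L s : ℕ} (hL : L = 2 * s + 1) (hd : 1 ≤ d) {a : ℝ} (ha : 0 ≤ a) {n : Site d}
    (hn : ∀ j, (n j).natAbs ≤ s) (κ : Fin d) :
    (l1 (lowPart κ n) : ℝ) * a +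
        a * ((s : ℝ) * ((L : ℝ) * ∑ μ : Fin d, (if κ < μ then (1 : ℝ) else 0)) +
          (s : ℝ) ^ 2 * ((d : ℝ) * ((d : ℝ) - 1) / 2)) ≤ omegaC d L a := by
  set cl : ℝ := ∑ i : Fin d, (if i < κ then (1 : ℝ) else 0) with hcl
  set cg : ℝ := ∑ μ : Fin d, (if κ < μ then (1 : ℝ) else 0) with hcg
  have hcl0 : 0 ≤ cl := Finset.sum_nonneg fun i _ => by split_ifs <;> norm_num
  have hcg0 : 0 ≤ cg := Finset.sum_nonneg fun i _ => by split_ifs <;> norm_num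
  have hcnt : cl + cg = (d : ℝ) - 1 := sum_lt_add_sum_gt κ
  have hl : (l1 (lowPart κ n) : ℝ) ≤ (s : ℝ) * cl := l1_lowPart_le_mul hn κ
  have hsL : ((L : ℝ) - 1) / 2 = s := by
    have : (L : ℝ) = 2 * s + 1 := by exact_mod_cast hL
    linarith
  have hs0 : (0 : ℝ) ≤ s := Nat.cast_nonneg _
  have hLe : (L : ℝ) = 2 * s + 1 := by exact_mod_cast hL
  have hL1 : (1 : ℝ) ≤ L := by linarith
  have hd1 : (1 : ℝ) ≤ d := by exact_mod_cast hd
  unfold omegaC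
  rw [hsL]
  have h1 : (l1 (lowPart κ n) : ℝ) * a ≤ (s : ℝ) * cl * a := mul_le_mul_of_nonneg_right hl ha
  have h2 : (s : ℝ) * cl * a ≤ (s : ℝ) * (L : ℝ) * cl * a := by
    have h : 0 ≤ (s : ℝ) * cl * a * ((L : ℝ) - 1) :=
      mul_nonneg (mul_nonneg (mul_nonneg hs0 hcl0) ha) (by linarith)
    nlinarith
  have h3 : 0 ≤ a * (s : ℝ) ^ 2 * ((d : ℝ) * ((d : ℝ) - 1)) :=
    mul_nonneg (mul_nonneg ha (sq_nonneg (s : ℝ))) (mul_nonneg (by linarith) (by linarith))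
  have key : (s : ℝ) * (L : ℝ) * cl * a + a * ((s : ℝ) * ((L : ℝ) * cg) + (s : ℝ) ^ 2 * ((d : ℝ) * ((d : ℝ) - 1) / 2)) =
      a * (s : ℝ) * (L : ℝ) * (cl + cg) + a * (s : ℝ) ^ 2 * ((d : ℝ) * ((d : ℝ) - 1)) / 2 := by ring
  rw [hcnt] at key
  have rhs : ((d : ℝ) - 1) * (s : ℝ) * ((d : ℝ) * s + L) * a =
      a * (s : ℝ) * (L : ℝ) * ((d : ℝ) - 1) + a * (s : ℝ) ^ 2 * ((d : ℝ) * ((d : ℝ) - 1)) := by ring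
  linarith

/-- **Crossing bonds** (p. 79, the bonds `b₀, b′, b″` of `B(c)` (1.23)): for `b = ⟨x, x + e_κ⟩`, `x = q + n ∈ B(q)` on the top layer
(`n_κ = s`), `x + e_κ ∈ B(q + Le_κ)`, with the axial conditions at `x` (tree at `q`) and at `x + e_κ` (tree at `q + Le_κ`):
`|V′_b − 1| ≤ 2ω + (α₁e^{3t} + e^{2t} − 1)` where `|X_c[U]|, |X_c[V₀]| ≤ t` — by the engine's `crossing_identity`.
[cite: Balaban1985RegularSpaces, Lemma 1 p.79] -/
theorem crossing_bound {L s : ℕ} (hL : L = 2 * s + 1) (U V₀ : Site d → Fin d → 𝔸ˣ) (hU : ∀ x κ, U x κ ∈ U1 𝔸)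
    (hV₀ : ∀ x κ, V₀ x κ ∈ U1 𝔸) {lo hi : Site d} {a : ℝ} (hPU : B8Lemma1NonAbelian.PlaqSmall U lo hi a)
    (hP0 : B8Lemma1NonAbelian.PlaqSmall V₀ lo hi a) (ha : 0 ≤ a) (q : Site d) (κ : Fin d) (hlo : lo ≤ pairLo L q)
    (hhi : pairHi L q κ ≤ hi) (n : Site d) (hn : ∀ j, (n j).natAbs ≤ s) (hnκ : n κ = s)
    (hAx : axialFn U q (q + n) = axialFn V₀ q (q + n))
    (hAx₁ : axialFn U (q + (L : ℤ) • e κ) (q + n + e κ) = axialFn V₀ (q + (L : ℤ) • e κ) (q + n + e κ))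
    {t α₁ : ℝ} (ht0 : 0 ≤ t) (htU : ‖XZ L U q κ‖ ≤ t) (ht₀ : ‖XZ L V₀ q κ‖ ≤ t) (hα₁ : 0 ≤ α₁)
    (havg : ‖(bavgZ L U q κ : 𝔸) - bavgZ L V₀ q κ‖ ≤ α₁) :
    ‖((pert U V₀ (q + n) κ : 𝔸ˣ) : 𝔸) - 1‖ ≤ 2 * omegaC d L a + (α₁ * Real.exp t ^ 3 + (Real.exp t ^ 2 - 1)) := by
  have hd : 1 ≤ d := Nat.one_le_iff_ne_zero.mpr (fun h => by subst h; exact Fin.elim0 κ)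
  set x := q + n with hx
  set q' := q + (L : ℤ) • e κ with hq'
  set n' : Site d := n + e κ - (L : ℤ) • e κ with hn'def
  have hx' : x + e κ = q' + n' := by rw [hx, hq', hn'def]; abel
  have hn' : ∀ j, (n' j).natAbs ≤ s := by
    intro j
    have := hn j
    by_cases hj : j = κ
    · subst hj
      simp only [hn'def, Pi.sub_apply, Pi.add_apply, e_apply_self, zsmul_e_apply_self, hnκ]; omega
    · simp only [hn'def, Pi.sub_apply, Pi.add_apply, e_apply_of_ne hj, zsmul_e_apply, if_neg hj]; simpa using this
  -- box memberships
  have hq : lo ≤ q ∧ q ≤ hi := ⟨hlo.trans (base_mem_pairBox hL q κ).1, (base_mem_pairBox hL q κ).2.trans hhi⟩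
  have hxb' := (mem_pairBox_blocks hL q κ hn).1
  have hxb : lo ≤ x ∧ x ≤ hi := ⟨hlo.trans hxb'.1, hxb'.2.trans hhi⟩
  have hxeb' := (mem_pairBox_blocks hL q κ hn').2
  rw [← hq', ← hx'] at hxeb'
  have hxeb : lo ≤ x + e κ ∧ x + e κ ≤ hi := ⟨hlo.trans hxeb'.1, hxeb'.2.trans hhi⟩
  -- the five factors
  have hbU := (axial_bond_bound_box U hU hPU ha q x κ hxb.1 hq.1 hxeb.2 hq.2).1
  have hb0 := (axial_bond_bound_box V₀ hV₀ hP0 ha q x κ hxb.1 hq.1 hxeb.2 hq.2).1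
  rw [hx, add_sub_cancel_left, ← hx] at hbU hb0
  have hTf : ∀ W : Site d → Fin d → 𝔸ˣ,
      Tfac L W q κ (x + e κ) = hol (gaugeAct (axialFn W q) W) q' (treeWord n') := by
    intro W; rw [Tfac, ← hq', hx', add_sub_cancel_left]
  have hTU := norm_axial_tree_sub_one_le hL U hU hPU ha q κ hlo hhi n' hn'
  have hT0 := norm_axial_tree_sub_one_le hL V₀ hV₀ hP0 ha q κ hlo hhi n' hn'
  rw [← hq', ← hTf] at hTU hT0
  have hh := norm_segRatio_sub_one_le L U V₀ hV₀ q κ ht0 htU ht₀ hα₁ havg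
  have hbr := bond_tree_le_omega hL hd ha hn κ
  rw [crossing_identity L U V₀ q x κ hAx hAx₁, Units.val_mul, Units.val_mul]
  refine (norm_units_inv_conj_sub_one_le (axialFn_mem hV₀ q x) _).trans ?_
  have mUq : ∀ z μ, gaugeAct (axialFn U q) U z μ ∈ U1 𝔸 := gaugeAct_mem hU (axialFn_mem hU q)
  have m0q : ∀ z μ, gaugeAct (axialFn V₀ q) V₀ z μ ∈ U1 𝔸 := gaugeAct_mem hV₀ (axialFn_mem hV₀ q)
  have mTU : Tfac L U q κ (x + e κ) ∈ U1 𝔸 := by rw [hTf]; exact hol_mem mUq _ _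
  have mT0 : Tfac L V₀ q κ (x + e κ) ∈ U1 𝔸 := by rw [hTf]; exact hol_mem m0q _ _
  have mh : hol U q (seg κ L) * (hol V₀ q (seg κ L))⁻¹ ∈ U1 𝔸 :=
    (U1 𝔸).mul_mem (hol_mem hU _ _) ((U1 𝔸).inv_mem (hol_mem hV₀ _ _))
  calc _ ≤ ‖((gaugeAct (axialFn U q) U x κ : 𝔸ˣ) : 𝔸) - 1‖
          + ‖(((Tfac L U q κ (x + e κ))⁻¹ : 𝔸ˣ) : 𝔸) - 1‖
          + ‖((hol U q (seg κ L) * (hol V₀ q (seg κ L))⁻¹ : 𝔸ˣ) : 𝔸) - 1‖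
          + ‖((Tfac L V₀ q κ (x + e κ) : 𝔸ˣ) : 𝔸) - 1‖
          + ‖(((gaugeAct (axialFn V₀ q) V₀ x κ)⁻¹ : 𝔸ˣ) : 𝔸) - 1‖ := by
        refine (norm_units_mul_sub_one_le ?_).trans (add_le_add ((norm_units_mul_sub_one_le ?_).trans
          (add_le_add ((norm_units_mul_sub_one_le ?_).trans (add_le_add (norm_units_mul_sub_one_le (mUq x κ))
          le_rfl)) le_rfl)) le_rfl)
        · exact (U1 𝔸).mul_mem ((U1 𝔸).mul_mem ((U1 𝔸).mul_mem (mUq x κ) ((U1 𝔸).inv_mem mTU)) mh) mT0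
        · exact (U1 𝔸).mul_mem ((U1 𝔸).mul_mem (mUq x κ) ((U1 𝔸).inv_mem mTU)) mh
        · exact (U1 𝔸).mul_mem (mUq x κ) ((U1 𝔸).inv_mem mTU)
    _ ≤ (l1 (lowPart κ n) : ℝ) * a
          + a * ((s : ℝ) * ((L : ℝ) * ∑ μ : Fin d, (if κ < μ then (1 : ℝ) else 0)) +
              (s : ℝ) ^ 2 * ((d : ℝ) * ((d : ℝ) - 1) / 2))
          + (α₁ * Real.exp t ^ 3 + (Real.exp t ^ 2 - 1))
          + a * ((s : ℝ) * ((L : ℝ) * ∑ μ : Fin d, (if κ < μ then (1 : ℝ) else 0)) +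
              (s : ℝ) ^ 2 * ((d : ℝ) * ((d : ℝ) - 1) / 2))
          + (l1 (lowPart κ n) : ℝ) * a := by
        refine add_le_add (add_le_add (add_le_add (add_le_add hbU ?_) hh) hT0) ?_
        · exact (norm_inv_sub_one_le mTU).trans hTU
        · exact (norm_inv_sub_one_le (m0q x κ)).trans hb0
    _ ≤ 2 * omegaC d L a + (α₁ * Real.exp t ^ 3 + (Real.exp t ^ 2 - 1)) := by linarith

/-! ### The hypotheses of Lemma 1 at one coarse bond and the two conclusions -/

/-- **The hypotheses of Lemma 1 for one coarse bond `c = ⟨q, q + Le_κ⟩` of the CENTRED lattice** (p. 79): `V₀` and `U = V′V₀` take values in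
`U1 𝔸` and satisfy (1.7) for `k = 1`, `|V(∂p) − 1| ≤ a` (`a = α₀L⁻²`), on the plaquettes of `B(c₋) ∪ B(c₊) = [q − s𝟙, q + Le_κ + s𝟙]`; (1.24): the
axial conditions `(R(V₀)V′)(Γ_{z,x}) = 1`, `x ∈ B(z)`, for both blocks `z = c₋, c₊`, trees from the block CENTRES (the record's radial datum), in
the transporter form `U(Γ_{z,x}) = V₀(Γ_{z,x})`, and `|Ū_c − V̄₀,c| ≤ α₁` for the RECORD averages (0.4) `bavgZ`. The engine's
`B8Lemma1NonAbelian.Hyp` with `boxVec ↦ offZ`, `bavg ↦ bavgZ`. [cite: Balaban1985RegularSpaces, (1.7) p.77, (1.24) p.79; Balaban1987RG1, (0.4) p.253] -/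
structure Hyp (L : ℕ) (U V₀ : Site d → Fin d → 𝔸ˣ) (q : Site d) (κ : Fin d) (a α₁ : ℝ) : Prop where
  memU : ∀ x μ, U x μ ∈ U1 𝔸
  memV₀ : ∀ x μ, V₀ x μ ∈ U1 𝔸
  plaqU : B8Lemma1NonAbelian.PlaqSmall U (pairLo L q) (pairHi L q κ) a
  plaqV₀ : B8Lemma1NonAbelian.PlaqSmall V₀ (pairLo L q) (pairHi L q κ) a
  axial : ∀ r : Fin d → Fin L, axialFn U q (q + offZ L r) = axialFn V₀ q (q + offZ L r)
  axial₁ : ∀ r : Fin d → Fin L, axialFn U (q + (L : ℤ) • e κ) (q + (L : ℤ) • e κ + offZ L r)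
    = axialFn V₀ (q + (L : ℤ) • e κ) (q + (L : ℤ) • e κ + offZ L r)
  avg : ‖(bavgZ L U q κ : 𝔸) - bavgZ L V₀ q κ‖ ≤ α₁

/-- **Lemma 1, explicit form, every bond of `B(c₋) ∪ B(c₊)`** (record average, centred blocks): for odd `L = 2s+1`, under `Hyp` with
`6ω ≤ 1`, `ω = (d−1)·s·(ds + L)·a`, every bond `b` with both ends in `B(c₋) ∪ B(c₊)` has `|V′_b − 1| ≤ α₁ + ω(10 + 12α₁)`.
[cite: Balaban1985RegularSpaces, Lemma 1 pp.79–80; Balaban1987RG1, (0.4) p.253] -/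
theorem lemma1_explicit {L s : ℕ} (hL : L = 2 * s + 1) {U V₀ : Site d → Fin d → 𝔸ˣ} {q : Site d} {κ : Fin d}
    {a α₁ : ℝ} (H : Hyp L U V₀ q κ a α₁) (ha : 0 ≤ a) (hα₁ : 0 ≤ α₁) (hω : 6 * omegaC d L a ≤ 1)
    (x : Site d) (ν : Fin d) (hx : InPair L q κ x) (hxν : InPair L q κ (x + e ν)) :
    ‖((pert U V₀ x ν : 𝔸ˣ) : 𝔸) - 1‖ ≤ α₁ + omegaC d L a * (10 + 12 * α₁) := by
  have hd : 1 ≤ d := Nat.one_le_iff_ne_zero.mpr (fun h => by subst h; exact Fin.elim0 κ)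
  have hL1 : 1 ≤ L := by omega
  set ω := omegaC d L a with hωdef
  have hω0 : 0 ≤ ω := omegaC_nonneg hL1 hd ha
  set lo := pairLo L q with hlodef
  set hi := pairHi L q κ with hhidef
  have hq : lo ≤ q ∧ q ≤ hi := base_mem_pairBox hL q κ
  -- `2·(d−1)·s·a ≤ 2ω ≤ α₁ + ω(10 + 12α₁)`
  have hsL : ((L : ℝ) - 1) / 2 = s := by
    have : (L : ℝ) = 2 * s + 1 := by exact_mod_cast hL
    linarith
  have hNN : 2 * (((d : ℝ) - 1) * (s : ℝ) * a) ≤ α₁ + ω * (10 + 12 * α₁) := by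
    have hd1 : (1 : ℝ) ≤ d := by exact_mod_cast hd
    have hLr : (1 : ℝ) ≤ L := by exact_mod_cast hL1
    have hs0 : (0 : ℝ) ≤ s := Nat.cast_nonneg _
    have h3 : 0 ≤ ((d : ℝ) - 1) * (s : ℝ) * a := mul_nonneg (mul_nonneg (by linarith) hs0) ha
    have h4 : ((d : ℝ) - 1) * (s : ℝ) * a ≤ ω := by
      rw [hωdef, omegaC, hsL]
      have : 0 ≤ ((d : ℝ) - 1) * (s : ℝ) * a * ((d : ℝ) * s + L - 1) :=
        mul_nonneg h3 (by nlinarith)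
      nlinarith
    nlinarith
  -- interior bonds of a block with centre `z ∈ {q, q + Le_κ}`
  have interior : ∀ z : Site d, lo ≤ z → z ≤ hi →
      (∀ r : Fin d → Fin L, axialFn U z (z + offZ L r) = axialFn V₀ z (z + offZ L r)) →
      ∀ (r r'' : Fin d → Fin L), x = z + offZ L r → x + e ν = z + offZ L r'' →
      lo ≤ x → x + e ν ≤ hi →
      ‖((pert U V₀ x ν : 𝔸ˣ) : 𝔸) - 1‖ ≤ α₁ + ω * (10 + 12 * α₁) := by
    intro z hz hz' hax r r'' hxr hxr'' hxlo hxhi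
    have hb := interior_bound U V₀ H.memU H.memV₀ H.plaqU H.plaqV₀ ha z x ν hz hz' hxlo hxhi
      (by rw [hxr]; exact hax r) (by rw [hxr'']; exact hax r'')
    rw [hxr, add_sub_cancel_left, ← hxr] at hb
    have hl := l1_lowPart_le_mul (natAbs_offZ_le hL r) ν
    have hcnt := sum_lt_add_sum_gt ν (d := d)
    have hcg : 0 ≤ ∑ μ : Fin d, (if ν < μ then (1 : ℝ) else 0) := Finset.sum_nonneg fun i _ => by split_ifs <;> norm_num
    have hs0 : (0 : ℝ) ≤ s := Nat.cast_nonneg _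
    have : (l1 (lowPart ν (offZ L r)) : ℝ) ≤ (s : ℝ) * ((d : ℝ) - 1) := by nlinarith
    refine hb.trans (le_trans ?_ hNN)
    nlinarith
  rcases hx with hx | hx <;> rcases hxν with hxν | hxν
  · -- both ends in `B(c₋)`
    obtain ⟨r, hr⟩ := hx
    obtain ⟨r'', hr''⟩ := hxν
    have hxb := (mem_pairBox_blocks hL q κ (natAbs_offZ_le hL r)).1
    have hxνb := (mem_pairBox_blocks hL q κ (natAbs_offZ_le hL r'')).1
    rw [← hr] at hxb; rw [← hr''] at hxνb
    exact interior q hq.1 hq.2 H.axial r r'' hr hr'' hxb.1 hxνb.2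
  · -- `x ∈ B(c₋)`, `x + e ν ∈ B(c₊)`: a crossing bond, `ν = κ`, top layer
    obtain ⟨r, hr⟩ := hx
    have h1 := (inBlock_iff hL q x).mp ⟨r, hr⟩
    have h2 := (inBlock_iff hL _ (x + e ν)).mp hxν
    have hνκ : ν = κ := by
      by_contra h
      have h1κ := h1 κ
      have h2κ := h2 κ
      simp only [Pi.add_apply, zsmul_e_apply_self, e_apply_of_ne (Ne.symm h)] at h2κ
      omega
    subst hνκ
    set n := offZ L r with hndef
    have hn : ∀ j, (n j).natAbs ≤ s := natAbs_offZ_le hL r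
    have hnν : n ν = s := by
      have h1ν := h1 ν
      have h2ν := h2 ν
      simp only [hr, Pi.add_apply, zsmul_e_apply_self, e_apply_self, add_sub_cancel_left] at h1ν h2ν
      have : x ν = q ν + n ν := by rw [hr]; rfl
      omega
    obtain ⟨r'', hr''⟩ := hxν
    have hω2 : ω ≤ 1 / 2 := by linarith
    have htU := norm_XZ_le hL U H.memU H.plaqU ha q ν le_rfl le_rfl hω2
    have ht0 := norm_XZ_le hL V₀ H.memV₀ H.plaqV₀ ha q ν le_rfl le_rfl hω2
    have hAx₁ : axialFn U (q + (L : ℤ) • e ν) (q + n + e ν) = axialFn V₀ (q + (L : ℤ) • e ν) (q + n + e ν) := by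
      rw [hndef, ← hr, hr'']; exact H.axial₁ r''
    have hc := crossing_bound hL U V₀ H.memU H.memV₀ H.plaqU H.plaqV₀ ha q ν le_rfl le_rfl n hn hnν
      (H.axial r) hAx₁ (by positivity) htU ht0 hα₁ H.avg
    rw [hndef, ← hr] at hc
    refine hc.trans ?_
    have e3 : Real.exp (2 * ω) ^ 3 ≤ 1 + 12 * ω := by
      have := exp_pow_le_one_add (2 * ω) 3 (by positivity) (by push_cast; linarith)
      push_cast at this; linarith
    have e2 : Real.exp (2 * ω) ^ 2 ≤ 1 + 8 * ω := by
      have := exp_pow_le_one_add (2 * ω) 2 (by positivity) (by push_cast; linarith)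
      push_cast at this; linarith
    nlinarith [mul_le_mul_of_nonneg_left e3 hα₁]
  · -- `x ∈ B(c₊)`, `x + e ν ∈ B(c₋)`: impossible
    exfalso
    have h1 := (inBlock_iff hL _ x).mp hx κ
    have h2 := (inBlock_iff hL q (x + e ν)).mp hxν κ
    simp only [Pi.add_apply, zsmul_e_apply_self, e_apply] at h1 h2
    split_ifs at h2 <;> omega
  · -- both ends in `B(c₊)`
    obtain ⟨r, hr⟩ := hx
    obtain ⟨r'', hr''⟩ := hxν
    have hxb := (mem_pairBox_blocks hL q κ (natAbs_offZ_le hL r)).2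
    have hxνb := (mem_pairBox_blocks hL q κ (natAbs_offZ_le hL r'')).2
    rw [← hr] at hxb; rw [← hr''] at hxνb
    have hz : ∀ j, ((0 : Site d) j).natAbs ≤ s := fun j => by simp
    have hqL := (mem_pairBox_blocks hL q κ hz).2
    rw [add_zero] at hqL
    exact interior (q + (L : ℤ) • e κ) hqL.1 hqL.2 H.axial₁ r r'' hr hr'' hxb.1 hxνb.2

/-- **Lemma 1 with the printed constant** (1.25), RECORD AVERAGE: for odd `L = 2s+1`, `a = α₀L⁻²`, `0 < α₀ ≤ 1∕(6(d+1)(d+2))`, `0 ≤ α₁ ≤ 1∕6`,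
every bond `b ⊂ B(c₋) ∪ B(c₊)` has `|V′_b − 1| < 4d²α₀ + α₁` — indeed `≤ α₁ + 12ω`, `ω ≤ (d−1)(d+2)α₀∕4`, and `3(d−1)(d+2) < 4d²`
(`d² − 3d + 6 > 0`). The smallness constant `1∕(6(d+1)(d+2))` replaces the engine's `1∕(6(d+1))` (the record's loops are longer).
[cite: Balaban1985RegularSpaces, Lemma 1 (1.25) p.79; Balaban1987RG1, (0.4) p.253] -/
theorem lemma1_printedBound {L s : ℕ} (hL : L = 2 * s + 1) {U V₀ : Site d → Fin d → 𝔸ˣ} {q : Site d} {κ : Fin d}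
    {α₀ α₁ : ℝ} (H : Hyp L U V₀ q κ (α₀ / (L : ℝ) ^ 2) α₁) (hα₀ : 0 < α₀)
    (hα₀' : α₀ ≤ 1 / (6 * ((d : ℝ) + 1) * ((d : ℝ) + 2))) (hα₁ : 0 ≤ α₁) (hα₁' : α₁ ≤ 1 / 6)
    (x : Site d) (ν : Fin d) (hx : InPair L q κ x) (hxν : InPair L q κ (x + e ν)) :
    ‖((pert U V₀ x ν : 𝔸ˣ) : 𝔸) - 1‖ < 4 * (d : ℝ) ^ 2 * α₀ + α₁ := by
  have hd : 1 ≤ d := Nat.one_le_iff_ne_zero.mpr (fun h => by subst h; exact Fin.elim0 κ)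
  have hL1 : 1 ≤ L := by omega
  have h1 : (1 : ℝ) ≤ L := by exact_mod_cast hL1
  have h2 : (1 : ℝ) ≤ d := by exact_mod_cast hd
  have hLpos : (0 : ℝ) < L := by linarith
  have hsL : ((L : ℝ) - 1) / 2 = s := by
    have : (L : ℝ) = 2 * s + 1 := by exact_mod_cast hL
    linarith
  have hs0 : (0 : ℝ) ≤ s := Nat.cast_nonneg _
  -- `ω ≤ (d−1)(d+2)α₀/4`
  have hωle : omegaC d L (α₀ / (L : ℝ) ^ 2) ≤ ((d : ℝ) - 1) * ((d : ℝ) + 2) * α₀ / 4 := by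
    unfold omegaC
    rw [hsL]
    have hs2 : (s : ℝ) = ((L : ℝ) - 1) / 2 := by linarith
    have key : (s : ℝ) * ((d : ℝ) * s + L) ≤ (L : ℝ) ^ 2 * (((d : ℝ) + 2) / 4) := by
      have hid : (L : ℝ) ^ 2 * (((d : ℝ) + 2) / 4) - (s : ℝ) * ((d : ℝ) * s + L) =
          ((d : ℝ) * (2 * L - 1) + 2 * L) / 4 := by rw [hs2]; ring
      have hpos : 0 ≤ (d : ℝ) * (2 * L - 1) + 2 * L := by nlinarith
      linarith
    have hfac : 0 ≤ ((d : ℝ) - 1) * (α₀ / (L : ℝ) ^ 2) := mul_nonneg (by linarith) (by positivity)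
    calc ((d : ℝ) - 1) * (s : ℝ) * ((d : ℝ) * s + L) * (α₀ / (L : ℝ) ^ 2)
        = (((d : ℝ) - 1) * (α₀ / (L : ℝ) ^ 2)) * ((s : ℝ) * ((d : ℝ) * s + L)) := by ring
      _ ≤ (((d : ℝ) - 1) * (α₀ / (L : ℝ) ^ 2)) * ((L : ℝ) ^ 2 * (((d : ℝ) + 2) / 4)) :=
        mul_le_mul_of_nonneg_left key hfac
      _ = ((d : ℝ) - 1) * ((d : ℝ) + 2) * α₀ / 4 := by field_simp
  -- `(d−1)(d+2)α₀ ≤ 1/6`, whence `6ω ≤ 1`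
  have hA : ((d : ℝ) + 1) * ((d : ℝ) + 2) * α₀ ≤ 1 / 6 := by
    calc ((d : ℝ) + 1) * ((d : ℝ) + 2) * α₀ ≤ ((d : ℝ) + 1) * ((d : ℝ) + 2) * (1 / (6 * ((d : ℝ) + 1) * ((d : ℝ) + 2))) :=
          mul_le_mul_of_nonneg_left hα₀' (by positivity)
      _ = 1 / 6 := by field_simp
  have hB : ((d : ℝ) - 1) * ((d : ℝ) + 2) * α₀ ≤ ((d : ℝ) + 1) * ((d : ℝ) + 2) * α₀ := by nlinarith [hα₀.le]
  have hω : 6 * omegaC d L (α₀ / (L : ℝ) ^ 2) ≤ 1 := by linarith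
  have hb := lemma1_explicit hL H (by positivity) hα₁ hω x ν hx hxν
  have hω0 : 0 ≤ omegaC d L (α₀ / (L : ℝ) ^ 2) := omegaC_nonneg hL1 hd (by positivity)
  -- `3(d−1)(d+2) < 4d²`
  have hdd : 4 * (d : ℝ) ^ 2 * α₀ - 3 * (((d : ℝ) - 1) * ((d : ℝ) + 2) * α₀) > 0 := by
    have : (0 : ℝ) < ((d : ℝ) ^ 2 - 3 * d + 6) * α₀ := mul_pos (by nlinarith) hα₀
    nlinarith
  refine hb.trans_lt ?_
  nlinarith [mul_le_mul_of_nonneg_left hα₁' hω0]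

end Lemma1


/-! ## §8 The DAG leaf `B8.Lemma1Printed d fam` for the RECORD carriers `blockPairNA d L 𝔸` (centred lattice, odd `L`) -/

section Leaf

variable {𝔸 : Type*} [NormedRing 𝔸] [NormOneClass 𝔸] [NormedAlgebra ℂ 𝔸] [CompleteSpace 𝔸]

/-- **`small α₀ V₀ V′`** of the carrier: `V₀`, `V′` are `U1 𝔸`-valued and `V₀`, `V′V₀` satisfy (1.7) for `k = 1`, `|V(∂p) − 1| < α₀L⁻²`, on the
plaquettes of `B(c₋) ∪ B(c₊) = [q − s𝟙, q + Le_κ + s𝟙]` (centred blocks). [cite: Balaban1985RegularSpaces, (1.7) p.77, Lemma 1 p.79] -/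
def Small (L : ℕ) (q : Site d) (κ : Fin d) (α₀ : ℝ) (V₀ V' : Site d → Fin d → 𝔸ˣ) : Prop :=
  (∀ x μ, V₀ x μ ∈ U1 𝔸) ∧ (∀ x μ, V' x μ ∈ U1 𝔸) ∧
    B8Lemma1NonAbelian.PlaqSmallLT V₀ (pairLo L q) (pairHi L q κ) (α₀ / (L : ℝ) ^ 2) ∧
    B8Lemma1NonAbelian.PlaqSmallLT (mulCfg V' V₀) (pairLo L q) (pairHi L q κ) (α₀ / (L : ℝ) ^ 2)

/-- **`axialClose α₁ V₀ V′`** of the carrier = (1.24) on `B(c₋) ∪ B(c₊)`: the axial conditions from the two block CENTRES (the record's radial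
datum) in transporter form, and `|\overline{V′V₀}_c − V̄₀,c| < α₁` for the RECORD averages (0.4) `bavgZ`. [cite: Balaban1985RegularSpaces, (1.24) p.79; Balaban1987RG1, (0.4) p.253] -/
def AxialClose (L : ℕ) (q : Site d) (κ : Fin d) (α₁ : ℝ) (V₀ V' : Site d → Fin d → 𝔸ˣ) : Prop :=
  (∀ r : Fin d → Fin L, axialFn (mulCfg V' V₀) q (q + offZ L r) = axialFn V₀ q (q + offZ L r)) ∧
  (∀ r : Fin d → Fin L, axialFn (mulCfg V' V₀) (q + (L : ℤ) • e κ) (q + (L : ℤ) • e κ + offZ L r)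
      = axialFn V₀ (q + (L : ℤ) • e κ) (q + (L : ℤ) • e κ + offZ L r)) ∧
  ‖(bavgZ L (mulCfg V' V₀) q κ : 𝔸) - bavgZ L V₀ q κ‖ < α₁

omit [NormOneClass 𝔸] [NormedAlgebra ℂ 𝔸] [CompleteSpace 𝔸] in
/-- The sites of the centred block `B(q)` as a `Finset`. [cite: Balaban1987RG1, (0.3) p.252] -/
def blockSites (L : ℕ) (q : Site d) : Finset (Site d) := Finset.univ.image fun r : Fin d → Fin L => q + offZ L r

omit [NormOneClass 𝔸] [NormedAlgebra ℂ 𝔸] [CompleteSpace 𝔸] in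
/-- `mem_blockSites` — bookkeeping. [cite: Balaban1987RG1, (0.3) p.252 (bookkeeping)] -/
theorem mem_blockSites {L : ℕ} {q x : Site d} : x ∈ blockSites L q ↔ InBlock L q x := by
  simp only [blockSites, Finset.mem_image, Finset.mem_univ, true_and, InBlock]
  exact ⟨fun ⟨r, hr⟩ => ⟨r, hr.symm⟩, fun ⟨r, hr⟩ => ⟨r, hr.symm⟩⟩

omit [NormOneClass 𝔸] [NormedAlgebra ℂ 𝔸] [CompleteSpace 𝔸] in
/-- The sites of `B(c₋) ∪ B(c₊)`. [cite: Balaban1985RegularSpaces, (1.23) p.79] -/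
def pairSites (L : ℕ) (q : Site d) (κ : Fin d) : Finset (Site d) :=
  blockSites L q ∪ blockSites L (q + (L : ℤ) • e κ)

omit [NormOneClass 𝔸] [NormedAlgebra ℂ 𝔸] [CompleteSpace 𝔸] in
/-- `mem_pairSites` — bookkeeping. [cite: Balaban1985RegularSpaces, (1.23) p.79 (bookkeeping)] -/
theorem mem_pairSites {L : ℕ} {q : Site d} {κ : Fin d} {x : Site d} :
    x ∈ pairSites L q κ ↔ InPair L q κ x := by
  simp [pairSites, InPair, mem_blockSites]

omit [NormOneClass 𝔸] [NormedAlgebra ℂ 𝔸] [CompleteSpace 𝔸] in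
/-- The bonds `b` with both ends in `B(c₋) ∪ B(c₊)` (p. 80 l. 2–4: the locality of (1.25)). [cite: Balaban1985RegularSpaces, (1.25) p.79, p.80] -/
def regionBonds (L : ℕ) (q : Site d) (κ : Fin d) : Finset (Site d × Fin d) :=
  ((pairSites L q κ) ×ˢ (univ : Finset (Fin d))).filter (fun b => b.1 + e b.2 ∈ pairSites L q κ)

omit [NormOneClass 𝔸] [NormedAlgebra ℂ 𝔸] [CompleteSpace 𝔸] in
/-- **`pertDev V′ = sup_b |V′_b − 1|`** over the bonds of `B(c₋) ∪ B(c₊)` (`0` for an empty region). [cite: Balaban1985RegularSpaces, (1.25) p.79] -/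
def pertDev (L : ℕ) (q : Site d) (κ : Fin d) (V' : Site d → Fin d → 𝔸ˣ) : ℝ :=
  if h : (regionBonds L q κ).Nonempty then (regionBonds L q κ).sup' h (fun b => ‖((V' b.1 b.2 : 𝔸ˣ) : 𝔸) - 1‖)
  else 0

omit [NormOneClass 𝔸] [NormedAlgebra ℂ 𝔸] [CompleteSpace 𝔸] in
/-- `pertDev_lt`: a strict bondwise bound on the region bounds `pertDev` (for a positive bound). [cite: Balaban1985RegularSpaces, Lemma 1 p.79 (bookkeeping)] -/
theorem pertDev_lt {L : ℕ} {q : Site d} {κ : Fin d} {V' : Site d → Fin d → 𝔸ˣ} {B : ℝ} (hB : 0 < B)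
    (h : ∀ x ν, InPair L q κ x → InPair L q κ (x + e ν) → ‖((V' x ν : 𝔸ˣ) : 𝔸) - 1‖ < B) :
    pertDev L q κ V' < B := by
  unfold pertDev
  split_ifs with hne
  · rw [Finset.sup'_lt_iff]
    intro b hb
    simp only [regionBonds, Finset.mem_filter, Finset.mem_product, Finset.mem_univ, and_true,
      mem_pairSites] at hb
    exact h b.1 b.2 hb.1 hb.2
  · exact hB

/-- **The non-abelian Lemma-1 carriers OF RECORD**: one `B8.LocalData` per coarse bond `c = ⟨q, q + Le_κ⟩` based at a block CENTRE `q` of `ℤᵈ`,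
configurations ∕ perturbations = `U1 𝔸`-valued bond fields, `small` = (1.7)`_{k=1}` for `V₀` and `V′V₀`, `axialClose` = (1.24) with the RECORD
average (0.4), `pertDev` = `sup |V′ − 1|`, all on `B(c₋) ∪ B(c₊)` — the engine's `blockPairNA` with `boxVec ↦ offZ`, `bavg ↦ bavgZ`.
[cite: Balaban1985RegularSpaces, Lemma 1 p.79, (1.23), p.80 l.2–4; Balaban1987RG1, (0.4) p.253] -/
def blockPairNA (d L : ℕ) (𝔸 : Type) [NormedRing 𝔸] [NormOneClass 𝔸] [NormedAlgebra ℂ 𝔸] [CompleteSpace 𝔸]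
    (c : Site d × Fin d) : B8.LocalData where
  Cfg := Site d → Fin d → 𝔸ˣ
  Pert := Site d → Fin d → 𝔸ˣ
  small := fun α₀ V₀ V' => Small L c.1 c.2 α₀ V₀ V'
  axialClose := fun α₁ V₀ V' => AxialClose L c.1 c.2 α₁ V₀ V'
  pertDev := fun V' => pertDev L c.1 c.2 V'

/-- **`B8.Lemma1Printed` (= the DAG leaf `DagBinding.B8LeafR.l1`) HOLDS for the record carriers `blockPairNA d L 𝔸`, odd `L`**, hypothesis-free,
with the smallness constant `c = 1∕(6(d+1)(d+2))` for «α₀, α₁ small». [cite: Balaban1985RegularSpaces, Lemma 1 (1.24)–(1.25) pp.79–80; Balaban1987RG1, (0.4) p.253] -/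
theorem lemma1Printed_blockPairNA (d L : ℕ) (hL : Odd L) (𝔸 : Type) [NormedRing 𝔸] [NormOneClass 𝔸] [NormedAlgebra ℂ 𝔸]
    [CompleteSpace 𝔸] : B8.Lemma1Printed d (blockPairNA d L 𝔸) := by
  obtain ⟨s, hs⟩ := hL
  refine ⟨1 / (6 * ((d : ℝ) + 1) * ((d : ℝ) + 2)), by positivity, ?_⟩
  rintro ⟨q, κ⟩ α₀ α₁ hα₀ hα₀' hα₁ hα₁' V₀ V' hS hA
  change pertDev L q κ V' < 4 * (d : ℝ) ^ 2 * α₀ + α₁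
  have hbound : 0 < 4 * (d : ℝ) ^ 2 * α₀ + α₁ := by positivity
  obtain ⟨hV₀, hV', hP0, hPU⟩ := hS
  obtain ⟨hax, hax₁, havg⟩ := hA
  have H : Hyp L (mulCfg V' V₀) V₀ q κ (α₀ / (L : ℝ) ^ 2) α₁ :=
    { memU := fun x μ => (U1 𝔸).mul_mem (hV' x μ) (hV₀ x μ)
      memV₀ := hV₀
      plaqU := hPU.le
      plaqV₀ := hP0.le
      axial := hax
      axial₁ := hax₁
      avg := havg.le }
  have hα₁6 : α₁ ≤ 1 / 6 :=
    hα₁'.trans (one_div_le_one_div_of_le (by norm_num) (by nlinarith [Nat.cast_nonneg (α := ℝ) d]))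
  refine pertDev_lt hbound fun x ν hx hxν => ?_
  have hb := lemma1_printedBound hs H hα₀ hα₀' hα₁.le hα₁6 x ν hx hxν
  rwa [pert_mulCfg] at hb

end Leaf

/-! ### Dictionary entry: `G ⊂ U(N)`, or the unitary group of any C⋆-algebra, is `U1`-valued -/

section UnitaryCase

variable {𝔸 : Type*} [CStarAlgebra 𝔸] [Nontrivial 𝔸]

/-- **Lemma 1 OF RECORD for unitary-valued fields** (the printed setting «`G ⊂ U(N)`», here the unitary group `B7Prop2Explicit.unitaryUnits 𝔸` of any
non-trivial C⋆-algebra): membership in `U1` is automatic, so `Hyp` only asks (1.7)`_{k=1}` and (1.24) (record average), and (1.25) follows with the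
printed constant. [cite: Balaban1985RegularSpaces, Lemma 1 p.79; Balaban1987RG1, (0.4) p.253] -/
theorem lemma1_unitary {L s : ℕ} (hL : L = 2 * s + 1) {V₀ V' : Site d → Fin d → 𝔸ˣ}
    (hV₀ : ∀ x μ, V₀ x μ ∈ B7Prop2Explicit.unitaryUnits 𝔸) (hV' : ∀ x μ, V' x μ ∈ B7Prop2Explicit.unitaryUnits 𝔸)
    {q : Site d} {κ : Fin d} {α₀ α₁ : ℝ}
    (hP0 : B8Lemma1NonAbelian.PlaqSmall V₀ (pairLo L q) (pairHi L q κ) (α₀ / (L : ℝ) ^ 2))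
    (hPU : B8Lemma1NonAbelian.PlaqSmall (mulCfg V' V₀) (pairLo L q) (pairHi L q κ) (α₀ / (L : ℝ) ^ 2))
    (hax : ∀ r : Fin d → Fin L, axialFn (mulCfg V' V₀) q (q + offZ L r) = axialFn V₀ q (q + offZ L r))
    (hax₁ : ∀ r : Fin d → Fin L, axialFn (mulCfg V' V₀) (q + (L : ℤ) • e κ) (q + (L : ℤ) • e κ + offZ L r)
      = axialFn V₀ (q + (L : ℤ) • e κ) (q + (L : ℤ) • e κ + offZ L r))
    (havg : ‖(bavgZ L (mulCfg V' V₀) q κ : 𝔸) - bavgZ L V₀ q κ‖ ≤ α₁)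
    (hα₀ : 0 < α₀) (hα₀' : α₀ ≤ 1 / (6 * ((d : ℝ) + 1) * ((d : ℝ) + 2))) (hα₁ : 0 ≤ α₁) (hα₁' : α₁ ≤ 1 / 6)
    (x : Site d) (ν : Fin d) (hx : InPair L q κ x) (hxν : InPair L q κ (x + e ν)) :
    ‖((V' x ν : 𝔸ˣ) : 𝔸) - 1‖ < 4 * (d : ℝ) ^ 2 * α₀ + α₁ := by
  have hV₀' : ∀ x μ, V₀ x μ ∈ U1 𝔸 := fun x μ => B7Prop2Explicit.unitaryUnits_le_U1 (hV₀ x μ)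
  have hV'' : ∀ x μ, V' x μ ∈ U1 𝔸 := fun x μ => B7Prop2Explicit.unitaryUnits_le_U1 (hV' x μ)
  have H : Hyp L (mulCfg V' V₀) V₀ q κ (α₀ / (L : ℝ) ^ 2) α₁ :=
    { memU := fun x μ => (U1 𝔸).mul_mem (hV'' x μ) (hV₀' x μ)
      memV₀ := hV₀'
      plaqU := hPU
      plaqV₀ := hP0
      axial := hax
      axial₁ := hax₁
      avg := havg }
  have hb := lemma1_printedBound hL H hα₀ hα₀' hα₁ hα₁' x ν hx hxν
  rwa [pert_mulCfg] at hb

end UnitaryCase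

end Literature.MathematicalPhysics.QuantumFieldTheory.Balaban1983to89.B8Lemma1NonAbelianRec

/-! ## Axiom audit (gate whitelist: `propext`, `Classical.choice`, `Quot.sound`) -/
#print axioms Literature.MathematicalPhysics.QuantumFieldTheory.Balaban1983to89.B8Lemma1NonAbelianRec.lemma1_explicit
#print axioms Literature.MathematicalPhysics.QuantumFieldTheory.Balaban1983to89.B8Lemma1NonAbelianRec.lemma1Printed_blockPairNA
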